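import Literature.NumberTheory.EllipticCurves.GreenbergVatsal2000.CharacterPAdicLFunctions
import Literature.NumberTheory.EllipticCurves.GreenbergVatsal2000.EisensteinCongruenceResidual
import Literature.NumberTheory.GaloisRepresentations.ModNCyclotomicCharacter
import HarnessLib

/-!
# Greenberg–Vatsal 2000, §3 Thm. (3.11) with display (28), at `χ = 1`: the EISENSTEIN CONGRUENCE
# `L_{Σ₀}(E/ℚ, T) ≡ u · L_{Σ₀}(C, T) L_{Σ₀}(D, T) (mod pΛ)`, `u ∈ ℤ_pˣ` — for `E/ℚ` with GOOD ORDINARY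
# OR MULTIPLICATIVE reduction at the odd prime `p` (the standing hypothesis of §3) admitting a
# rational `p`-isogeny with kernel ramified at `p` and even — filed through its consequence for the
# `μ`- and `λ`-invariants

HONEST FRAMING (BSD rank-`≤ 1` residual cell `b2b-bsdres`, home
`run/shared/lean/b2b/bsd-rank1-residual/`, unit `b2b-bsdres-eisenstein-p2`, class X2): the cell
deletes the COMBINATION-SHAPED residual classes of the rank-`≤ 1` BSD formula from PUBLISHED
theorems only and TYPES the construction-shaped ones; this is not "finishing BSD". This file records
ONE published NUMBERED statement as a named fact (`def … : Prop`, nothing asserted; D-0014/D-0026):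
Greenberg–Vatsal's Theorem (3.11) (with the factorisation (28) of its right-hand side), the ONLY
input of their proof of Thm. (1.3)/(1.5) in which the elliptic curve enters the analytic side. It
is stated by GV under the standing hypothesis of §3 — "`E` has either good ordinary or
multiplicative reduction at `p`" (p. 32) — and its proof treats the level divisible by `p`
explicitly (p. 43: "If `(p, M) ≠ 1`, then `M` must be divisible by precisely the first power of
`p`. In this case one can argue as follows …"); accordingly ONE statement covering both reduction
types is filed, with no transcription from one reduction type to the other. The character-theoretic
identities which GV combine with it on p. 43 (Ferrero–Washington, Mazur–Wiles, Props. (2.6)/(2.8))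
are the separate, curve-free named facts of `CharacterInvariants.lean`; the cell's earlier
reading-facts `nonPrimitive_unitContent_and_lambda_eq_residual_of_lineRamifiedEven` (multiplicative,
carrier of the referee's flag `GV00-mult-asserted`) and `…_goodOrd` FOLD Thm. (3.11) with those
identities and become kernel consequences of the unfolded facts
(`Summits/BirchSwinnertonDyer/Rank1Residual/X2/EisensteinCongruenceOfFacts.lean`).

Form filed. The congruence `L_{Σ₀}(E/ℚ,T) ≡ u·L(G,T) (mod πΛ)` with `u ∈ Oˣ` and
`L(G,T) = L_{Σ₀}(C,T)·L_{Σ₀}(D,T)` is filed through its consequence for the reductions modulo `p`: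
`L_{Σ₀}(E/ℚ,T) mod p = ū · (L_{Σ₀}(C,T) L_{Σ₀}(D,T)) mod p` with `ū ≠ 0`, i.e. the two sides have
unit content simultaneously and then the same `λ`-invariant `ord_T(· mod p)` — the form in which
GV use it on p. 43 ("We then obtain that `λ^{anal}_{E,Σ₀} = λ_{φ,Σ₀} + λ_{ψ,Σ₀}` … The vanishing of
`μ^{anal}_E` also follows from the congruence") and which is insensitive to the normalisation of the
variable `T` (`T ↦ (1+T)⁻¹ − 1`) and to units of `Λ`.

## Citation header (held text `paper:arxiv-math_9906215`, dvips stream decoded by this seat,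
## `…-g21-0/folder/work/lit/gv2000_decoded.txt`: p0055 = p. 32, p0065–p0066 = pp. 42–43)

* §3 p. 32: "Let `E` be a modular elliptic curve of conductor `N`, and let `p` be a fixed odd prime.
  We assume that `E` has either good ordinary or multiplicative reduction at `p`, corresponding to
  the two cases `(N, p) = 1` and `(p, N/p) = 1` respectively."
* p. 42: "Suppose that `φ` and `ψ` are as before, namely the `ℤ_pˣ`-valued characters corresponding
  to the composition factors `Φ` and `Ψ` in the `G_ℚ`-module `E[p]`, assuming that `E` admits a
  `ℚ`-isogeny of degree `p`. We assume that `ψ` is odd and unramified at `p`, or equivalently that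
  `φ` is even and ramified at `p`. In this case, the admissible sign is plus, and the canonical
  period is the real period of `E` (up to multiplication by a `p`-adic unit). Let `N` denote the
  level of `E` and let `Σ₀` denote any set of primes containing all primes `l ≠ p` dividing `N`, but
  not including `p`. Define `G = Σ b_n q^n` to be the weight-two Eisenstein series determined by
  `Σ b_n n^{−s} = L_{Σ₀}(ψ, s) L_{Σ₀}(ψ⁻¹, s − 1)`. … we let `L(G, χ, T)` denote the `p`-adic
  `L`-function (associated to `G` and `χ`) characterized by the interpolation property … Then we
  clearly have `L(G, χ, T) = L_{Σ₀}(C, χ, T) L_{Σ₀}(D, χ, T)`. (28)"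
* p. 43: "Theorem (1.3) is a consequence of the congruence in the following theorem. We just take
  `χ` to be the trivial character. We then obtain that `λ^{anal}_{E,Σ₀} = λ_{φ,Σ₀} + λ_{ψ,Σ₀}` …
  The vanishing of `μ^{anal}_E` also follows from the congruence. … **Theorem (3.11)** Let `χ` be
  any even character. Then we have congruence `L_{Σ₀}(E/ℚ, χ, T) ≡ u L(G, χ, T) (mod πΛ)`, where
  `u` is a unit in `O`. *Proof.* Let `f` denote the cuspform associated to `E`, and let `g` denote
  the form obtained by removing all Euler factors at primes `q ∈ Σ`. Then both `f` and `G` are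
  simultaneous eigenforms at some common level `M`. … If `(p, M) = 1`, then our contention follows
  immediately from the `q`-expansion principle. If `(p, M) ≠ 1`, then `M` must be divisible by
  precisely the first power of `p`. In this case one can argue as follows. … Hida's determination
  of the ordinary Eisenstein series ([Hid85], Thm. 5.8)".
* p. 3, display (3) (the Néron normalisation `L(E/ℚ, T)`, `…/Ω_E`), p. 9 (`L_{Σ₀}(E/ℚ, T) =
  L(E/ℚ, T) ∏_{ℓ∈Σ₀} 𝒫_ℓ(T)`; tree `eulerFactorProduct`), p. 28 ("`G_ℚ` acts … on `Ψ` by a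
  character `ψ`").

## The tree's vocabulary (no new definition)

`E/ℚ` on a globally minimal model `W`, `p ≠ 2` of good ordinary (`HasGoodReductionAtPrime`,
`p ∤ a_p`) OR multiplicative (`HasMultiplicativeReductionAtPrime`) reduction, `f` the newform
(`IsNewformOf`), `Φ₀ ≤ E[p]` a rational line ramified at `p` and even (`IsRationalLine`,
`¬ LineUnramifiedAt`, `LineEven`), `φ` and `ψ` the characters of `Φ₀` and of `Ψ = E[p]/Φ₀` (GV p. 28)
presented as PRIMITIVE Dirichlet characters mod `m`, resp. mod `d`, with values in `𝔽_p` through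
the cyclotomic characters (`σ • P = φ(χ_m(σ)) • P` on `Φ₀`, `σ • P ≡ ψ(χ_d(σ)) • P (mod Φ₀)` on
`E[p]`; Kronecker–Weber, tree `DirichletCharacterOfGaloisCharacter.lean`), `Σ₀ = S₀ ∌ p` finite ⊇ bad places `≠ p`; `ϖ ∈ ℚ` with
`ϖ · Ω_E = Ω⁺_f` and `L` the tree's `p`-adic `L`-function of `f` (`padicLFunction f (unitRoot W p)`
at good ordinary `p`; THE Mazur–Tate–Teitelbaum function `IsSplitMultPAdicLFunctionOf` /
`IsMultPAdicLFunctionOf f p (−1)` at `p ‖ N`), `b ∈ Λ` with `ι b = ϖ · L` — so `b · ∏_{ℓ∈Σ₀} 𝒫_ℓ`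
represents `L_{Σ₀}(E/ℚ, T)` (as in the sibling facts of `EisensteinCongruenceResidual[GoodOrdinary]`
and `MultiplicativeLambda`); `g_C`, `g_D` with `IsCharacterLFunctionC/D p ψ S₀` = `L_{Σ₀}(C, T)`,
`L_{Σ₀}(D, T)` (`CharacterPAdicLFunctions.lean`); `HasUnitContent` (`μ = 0`), `ord_T(· mod p)` (`λ`).
-/

noncomputable section

open scoped Classical MatrixGroups ModularForm

open NumberField IsDedekindDomain Field WeierstrassCurve CongruenceSubgroup PowerSeries
open Literature.NumberTheory.EllipticCurves Literature.NumberTheory.GaloisRepresentations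
  Literature.NumberTheory.EllipticCurves.ModularForms
  Literature.NumberTheory.EllipticCurves.Rank1Residual

namespace Literature.NumberTheory.EllipticCurves.GreenbergVatsal2000

/-- **Greenberg–Vatsal 2000, §3 Thm. (3.11) with display (28), `χ = 1`: the Eisenstein congruence
`L_{Σ₀}(E/ℚ, T) ≡ u · L_{Σ₀}(C, T) L_{Σ₀}(D, T) (mod pΛ)`, `u ∈ ℤ_pˣ`.** Thm. (3.11), p. 43: "Let `χ`
be any even character. Then we have congruence `L_{Σ₀}(E/ℚ, χ, T) ≡ u L(G, χ, T) (mod πΛ)`, where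
`u` is a unit in `O`"; (28), p. 42: "`L(G, χ, T) = L_{Σ₀}(C, χ, T) L_{Σ₀}(D, χ, T)`"; setting of
p. 42: "`φ` and `ψ` … the `ℤ_pˣ`-valued characters corresponding to the composition factors `Φ` and
`Ψ` in the `G_ℚ`-module `E[p]`, assuming that `E` admits a `ℚ`-isogeny of degree `p`. We assume
that `ψ` is odd and unramified at `p`, or equivalently that `φ` is even and ramified at `p`. … the
canonical period is the real period of `E` … `Σ₀` … any set of primes containing all primes `l ≠ p`
dividing `N`, but not including `p`"; standing hypothesis of §3, p. 32: "`p` … a fixed odd prime.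
We assume that `E` has either good ordinary or multiplicative reduction at `p`"; the proof of
Thm. (3.11) (p. 43) treats `(p, M) = 1` ("`q`-expansion principle") and `(p, M) ≠ 1` ("`M` must be
divisible by precisely the first power of `p` … Hida … Thm. 5.8") alike. TRANSCRIPTION (`χ = 1`;
the congruence through its consequence modulo `p`, which is how p. 43 uses it): for `E/ℚ` globally
minimal, `p ≠ 2` of good ordinary OR multiplicative reduction, `Φ₀` a rational line ramified at `p`
and even, `φ`, `ψ` the characters of `Φ₀` and of `E[p]/Φ₀` as primitive Dirichlet characters mod
`m`, `d` with values in `𝔽_p` (`σ • P = φ(χ_m(σ)) • P` on `Φ₀`, `σ • P ≡ ψ(χ_d(σ)) • P (mod Φ₀)`),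
`f` the newform, `S₀ = Σ₀ ∌ p` finite ⊇ bad places `≠ p`,
`ϖ · Ω_E = Ω⁺_f`, `L` the `p`-adic `L`-function of `f` (Mazur–Swinnerton-Dyer at good ordinary `p`,
Mazur–Tate–Teitelbaum at `p ‖ N`), `b ∈ Λ` with `ι b = ϖ · L`, and ANY `g_C = L_{Σ₀}(C, T)`,
`g_D = L_{Σ₀}(D, T)` (`IsCharacterLFunctionC/D`): `b·∏𝒫_ℓ` has unit content iff `g_C·g_D` does, and
then `ord_T((b·∏𝒫_ℓ) mod p) = ord_T((g_C·g_D) mod p)`. Named fact; nothing asserted.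
-- TODO(general form): GV prove the congruence itself, `L_{Σ₀}(E/ℚ,χ,T) ≡ u·L(G,χ,T) (mod πΛ)` with
-- a CONSTANT unit `u ∈ O = ℤ_p[χ]`, for every even Dirichlet character `χ`; only `χ = 1` and the
-- consequence for the reductions mod `p` (unit content, `ord_T`) is filed, which does not depend on
-- the orientation `T ↦ (1 + T)⁻¹ − 1` of the variable.
[cite: GreenbergVatsal2000, §3 Thm. (3.11) (p. 43) with display (28) (p. 42) and the standing hypothesis of §3 (p. 32)] -/
def thm311_hasUnitContent_iff_and_order_eq_of_lineRamifiedEven : Prop :=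
  ∀ (W : WeierstrassCurve ℚ) [W.IsGloballyMinimal] [W.IsElliptic] (p : ℕ) [Fact p.Prime]
    {N : ℕ} [NeZero N] (f : CuspForm (Gamma0 N) 2)
    (S₀ : Finset (HeightOneSpectrum (𝓞 ℚ)))
    (Φ₀ : AddSubgroup (W.geomTorsion (p : ℤ)))
    (m : ℕ) [NeZero m] (φ : DirichletCharacter (ZMod p) m)
    (d : ℕ) [NeZero d] (ψ : DirichletCharacter (ZMod p) d),
    p ≠ 2 →
    ((W.HasGoodReductionAtPrime p ∧ ¬ (p : ℤ) ∣ W.frobeniusTrace p) ∨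
      W.HasMultiplicativeReductionAtPrime p) →
    IsRationalLine W p Φ₀ → ¬ LineUnramifiedAt W p Φ₀ → LineEven W p Φ₀ → IsNewformOf W f →
    φ.IsPrimitive → ψ.IsPrimitive →
    (∀ (σ : absoluteGaloisGroup ℚ), ∀ P ∈ Φ₀,
      σ • P = (φ ((modNCyclotomicCharacter ℚ m σ : (ZMod m)ˣ) : ZMod m)).val • P) →
    (∀ (σ : absoluteGaloisGroup ℚ) (P : W.geomTorsion (p : ℤ)),
      σ • P - (ψ ((modNCyclotomicCharacter ℚ d σ : (ZMod d)ˣ) : ZMod d)).val • P ∈ Φ₀) →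
    (∀ v ∈ S₀, ((p : ℕ) : 𝓞 ℚ) ∉ v.asIdeal) →
    (∀ v : HeightOneSpectrum (𝓞 ℚ), v ∉ S₀ → ((p : ℕ) : 𝓞 ℚ) ∉ v.asIdeal →
      W.HasGoodReductionAt v) →
    ∀ (ϖ : ℚ), (ϖ : ℝ) * W.realPeriodRat = plusPeriod f →
    ∀ (L : PowerSeries ℚ_[p]),
      (W.HasGoodReductionAtPrime p → L = padicLFunction f (unitRoot W p : ℚ_[p])) →
      (W.HasSplitMultiplicativeReductionAtPrime p → IsSplitMultPAdicLFunctionOf f p L) →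
      (W.HasMultiplicativeReductionAtPrime p → ¬ W.HasSplitMultiplicativeReductionAtPrime p →
        IsMultPAdicLFunctionOf f p (-1) L) →
    ∀ (b : IwasawaAlgebra p),
      iwasawaToPowerSeries p b = PowerSeries.C ((ϖ : ℚ) : ℚ_[p]) * L →
    ∀ (gC gD : IwasawaAlgebra p), IsCharacterLFunctionC p φ S₀ gC →
      IsCharacterLFunctionD p ψ S₀ gD →
      (HasUnitContent (b * eulerFactorProduct W p S₀) ↔ HasUnitContent (gC * gD)) ∧
        (HasUnitContent (gC * gD) →
          (PowerSeries.map (PadicInt.toZMod (p := p)) (b * eulerFactorProduct W p S₀)).order =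
            (PowerSeries.map (PadicInt.toZMod (p := p)) (gC * gD)).order)

end Literature.NumberTheory.EllipticCurves.GreenbergVatsal2000

end
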